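import Mathlib.Analysis.SpecialFunctions.Integrals.Basic
import Mathlib.Analysis.Complex.Exponential
import Literature.MathematicalPhysics.QuantumLattice.LiebRobinsonProofs
import HarnessLib

/-!
# The Lieb–Robinson bound for finite quantum spin systems (iteration of the integral inequality)

Second layer of the Lieb–Robinson bound (third file of the Michalakis–Zwolak formalisation,
hubbard.S19): for a local interaction `Φ` on a finite set of sites `Λ` with
`Σ_{Z ∋ x} ‖Φ Z‖ ≤ J` for every site `x` and `#Z ≤ V` whenever `Φ Z ≠ 0`, and observables
`A ∈ 𝔄_X`, `B ∈ 𝔄_Y`,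

`‖[τ_t(A), B]‖ ≤ 2 ‖A‖ ‖B‖ (#X / V) exp(−μ δ(X) + 2 e^μ V J |t|)`   (`μ ≥ 0` arbitrary)

where `δ` is any **grading of the regions adapted to `Φ` and `Y`**: `δ Z > 0 ⟹ Z ∩ Y = ∅` and
`δ Z ≤ δ Z' + 1` whenever `Φ Z' ≠ 0` meets `Z` (`norm_comm_heisenbergEvolution_le_exp`). For a
finite-range interaction on a metric space of sites one takes `δ Z = ⌈d(Z, Y)/R⌉`, recovering the
usual form `C ‖A‖ ‖B‖ |X| e^{−μ'(d(X,Y) − v|t|)}`; keeping `δ` abstract makes the statement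
independent of the geometry (boxes of `ℤ^d`, decorated tori, …).

The proof is the iteration of the Nachtergaele–Ogata–Sims integral inequality
(`norm_comm_heisenbergEvolution_le` of `LiebRobinsonIntegralProofs`; the elementary helpers
`heisenbergEvolution_sum`, `norm_commutator_le`, `norm_sum_commutator_le`,
`isHermitian_sum_interaction` are reused from `LiebRobinsonProofs`, the `ℤ^d` instance of the
bound proved there for `lieb_robinson` by a Grönwall argument): with `c = 2VJ` one proves by
induction on `N` that for `s ≥ 0`

`‖[τ_s(A), B]‖ ≤ 2‖A‖‖B‖ (𝟙[δX = 0] + (#X/V)(Σ_{n = max(1,δX)}^{N} (cs)ⁿ/n! + (cs)^{N+1}/(N+1)!))`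

(`norm_comm_le_iterate`), lets `N → ∞`, and bounds the exponential tail
`Σ_{n ≥ a} xⁿ/n! ≤ e^{−μa} e^{e^μ x}`. Negative times are reduced to positive ones by `Φ ↦ −Φ`.

Sources: Nachtergaele–Sims, CMP **265** (2006) 119 = arXiv:math-ph/0506030, §3.1 (iteration
of the integral inequality, proof of Theorem 1); Nachtergaele–Ogata–Sims, J. Stat. Phys. **124**
(2006) 1 = arXiv:math-ph/0603064, Theorem 2.1 (the multi-site form with `Σ_{x∈X} Σ_{y∈Y}`);
Lieb–Robinson, CMP **28** (1972) 251. No definitions, no named facts (theorems only).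
-/

noncomputable section

open Matrix Complex Finset NormedSpace MeasureTheory intervalIntegral Filter
open scoped Matrix.Norms.L2Operator Nat Topology

namespace Literature.MathematicalPhysics.QuantumLattice

/-! ### Real-analysis bookkeeping -/

section Real

/-- `∫₀ˢ (c u)ⁿ/n! du = cⁿ s^{n+1}/(n+1)!`. [folklore] -/
theorem integral_mul_pow_div_factorial (c s : ℝ) (n : ℕ) :
    ∫ u in (0 : ℝ)..s, (c * u) ^ n / n ! = c ^ n * s ^ (n + 1) / (n + 1)! := by
  have h1 : (fun u : ℝ => (c * u) ^ n / n !) = fun u => (c ^ n / n !) * u ^ n := by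
    funext u; rw [mul_pow]; ring
  rw [h1, intervalIntegral.integral_const_mul, integral_pow, Nat.factorial_succ]
  push_cast
  have hn : (n ! : ℝ) ≠ 0 := by positivity
  have hn1 : ((n : ℝ) + 1) ≠ 0 := by positivity
  field_simp
  ring

/-- One term of the exponential tail: for `0 ≤ x`, `0 ≤ μ` and `a ≤ n`,
`xⁿ/n! ≤ e^{−μa} (e^μ x)ⁿ/n!`. [folklore] -/
theorem pow_div_factorial_le_exp_mul {x μ : ℝ} (hx : 0 ≤ x) (hμ : 0 ≤ μ) {a n : ℕ} (h : a ≤ n) :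
    x ^ n / n ! ≤ Real.exp (-(μ * a)) * ((Real.exp μ * x) ^ n / n !) := by
  rw [mul_pow, ← Real.exp_nat_mul, mul_div_assoc, ← mul_assoc, ← Real.exp_add]
  have h1 : 1 ≤ Real.exp (-(μ * a) + n * μ) := by
    rw [Real.one_le_exp_iff]
    have : (a : ℝ) ≤ n := by exact_mod_cast h
    nlinarith
  have h2 : 0 ≤ x ^ n / n ! := by positivity
  calc x ^ n / n ! = 1 * (x ^ n / n !) := (one_mul _).symm
    _ ≤ Real.exp (-(μ * a) + n * μ) * (x ^ n / n !) := mul_le_mul_of_nonneg_right h1 h2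

/-- **Tail of the exponential series**: for `0 ≤ x`, `0 ≤ μ`,
`Σ_{n = a}^{N} xⁿ/n! ≤ e^{−μa} e^{e^μ x}`. [folklore] -/
theorem sum_Icc_pow_div_factorial_le {x μ : ℝ} (hx : 0 ≤ x) (hμ : 0 ≤ μ) (a N : ℕ) :
    ∑ n ∈ Icc a N, x ^ n / n ! ≤ Real.exp (-(μ * a)) * Real.exp (Real.exp μ * x) := by
  have hex : 0 ≤ Real.exp μ * x := mul_nonneg (Real.exp_pos μ).le hx
  calc ∑ n ∈ Icc a N, x ^ n / n !
      ≤ ∑ n ∈ Icc a N, Real.exp (-(μ * a)) * ((Real.exp μ * x) ^ n / n !) :=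
        sum_le_sum fun n hn => pow_div_factorial_le_exp_mul hx hμ (mem_Icc.mp hn).1
    _ = Real.exp (-(μ * a)) * ∑ n ∈ Icc a N, (Real.exp μ * x) ^ n / n ! := by rw [mul_sum]
    _ ≤ Real.exp (-(μ * a)) * ∑ n ∈ range (N + 1), (Real.exp μ * x) ^ n / n ! := by
        refine mul_le_mul_of_nonneg_left ?_ (Real.exp_pos _).le
        refine sum_le_sum_of_subset_of_nonneg (fun n hn => ?_) fun n _ _ => by positivity
        rw [mem_range]
        exact Nat.lt_succ_of_le (mem_Icc.mp hn).2
    _ ≤ Real.exp (-(μ * a)) * Real.exp (Real.exp μ * x) :=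
        mul_le_mul_of_nonneg_left (Real.sum_le_exp_of_nonneg hex _) (Real.exp_pos _).le

/-- Reindexing step of the Lieb–Robinson iteration:
`x 𝟙[d ≤ 1] + Σ_{n = max(1, d−1)}^{N} x^{n+1}/(n+1)! ≤ Σ_{n = max(1,d)}^{N+1} xⁿ/n!`
(in fact an equality). [folklore] -/
theorem mul_indicator_add_sum_Icc_le (x : ℝ) (d N : ℕ) :
    x * (if d ≤ 1 then 1 else 0) + ∑ n ∈ Icc (max 1 (d - 1)) N, x ^ (n + 1) / (n + 1)! ≤
      ∑ n ∈ Icc (max 1 d) (N + 1), x ^ n / n ! := by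
  -- reindex the sum on the left
  have hre : ∑ n ∈ Icc (max 1 (d - 1)) N, x ^ (n + 1) / (n + 1)! =
      ∑ m ∈ Icc (max 1 (d - 1) + 1) (N + 1), x ^ m / m ! := by
    rw [← map_add_right_Icc, sum_map]
    rfl
  rw [hre]
  by_cases hd : d ≤ 1
  · rw [if_pos hd, mul_one]
    have h1 : max 1 (d - 1) + 1 = 2 := by omega
    have h2 : max 1 d = 1 := by omega
    rw [h1, h2]
    -- `Σ_{Icc 1 (N+1)} = x + Σ_{Icc 2 (N+1)}`
    have h3 : ∑ n ∈ Icc 1 (N + 1), x ^ n / n ! = x ^ 1 / (1 : ℕ)! + ∑ n ∈ Icc 2 (N + 1), x ^ n / n ! := by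
      rw [Icc_eq_cons_Ioc (by omega : 1 ≤ N + 1), sum_cons,
        show (2 : ℕ) = Order.succ 1 from rfl, Finset.Icc_succ_left_eq_Ioc]
    rw [h3]
    simp
  · rw [if_neg hd, mul_zero, zero_add]
    have h1 : max 1 (d - 1) + 1 = max 1 d := by omega
    rw [h1]

/-- Evaluation of the integral of the iteration bound:
`∫₀ˢ b (ι + Σ_{n=a}^{N} (cu)ⁿ/n! + (cu)^{N+1}/(N+1)!) du
  = b (s ι + Σ_{n=a}^{N} cⁿ s^{n+1}/(n+1)! + c^{N+1} s^{N+2}/(N+2)!)`. [folklore] -/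
theorem integral_iterBound (c s b ι : ℝ) (a N : ℕ) :
    ∫ u in (0 : ℝ)..s, b * (ι + (∑ n ∈ Icc a N, (c * u) ^ n / n ! + (c * u) ^ (N + 1) / (N + 1)!)) =
      b * (s * ι + (∑ n ∈ Icc a N, c ^ n * s ^ (n + 1) / (n + 1)! +
        c ^ (N + 1) * s ^ (N + 2) / (N + 2)!)) := by
  have hi1 : IntervalIntegrable (fun _ : ℝ => ι) volume 0 s := intervalIntegrable_const
  have hi2 : IntervalIntegrable (fun u : ℝ => ∑ n ∈ Icc a N, (c * u) ^ n / n !) volume 0 s :=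
    (continuous_finsetSum _ fun n _ => by fun_prop).intervalIntegrable 0 s
  have hi3 : IntervalIntegrable (fun u : ℝ => (c * u) ^ (N + 1) / (N + 1)!) volume 0 s :=
    (by fun_prop : Continuous fun u : ℝ => (c * u) ^ (N + 1) / (N + 1)!).intervalIntegrable 0 s
  rw [intervalIntegral.integral_const_mul, intervalIntegral.integral_add hi1 (hi2.add hi3),
    intervalIntegral.integral_add hi2 hi3, intervalIntegral.integral_const,
    intervalIntegral.integral_finsetSum fun n _ =>
      ((by fun_prop : Continuous fun u : ℝ => (c * u) ^ n / n !).intervalIntegrable 0 s),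
    integral_mul_pow_div_factorial]
  simp only [integral_mul_pow_div_factorial, sub_zero, smul_eq_mul]

end Real

/-! ### Lattice bookkeeping -/

section Lattice

variable {Λ : Type*} [Fintype Λ] [DecidableEq Λ] {q : ℕ}

omit [DecidableEq Λ] in
/-- The Hamiltonian of the whole system is the sum of all terms: `H_univ = Σ_Z Φ Z`. [folklore] -/
theorem localHamiltonian_univ (Φ : Interaction Λ q) : localHamiltonian Φ univ = ∑ Z, Φ Z := by
  rw [localHamiltonian, powerset_univ]

/-- Splitting the Hamiltonian into the terms touching a region `X` and the others:
`Σ_Z Φ Z − Σ_{Z ∩ X = ∅} Φ Z = Σ_{Z ∩ X ≠ ∅} Φ Z`. [folklore] -/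
theorem sum_sub_sum_filter_disjoint (Φ : Interaction Λ q) (X : Finset Λ) :
    ∑ Z, Φ Z - ∑ Z ∈ univ.filter (fun Z : Finset Λ => Disjoint Z X), Φ Z =
      ∑ Z ∈ univ.filter (fun Z : Finset Λ => ¬ Disjoint Z X), Φ Z := by
  rw [sub_eq_iff_eq_add, add_comm, sum_filter_add_sum_filter_not]

/-- The terms not touching `X` commute with every observable supported on `X` (locality,
`commute_of_disjoint_holds`). Nachtergaele–Ogata–Sims (2006), proof of Thm 2.1. [folklore] -/
theorem Interaction.IsLocal.commute_sum_filter_disjoint {Φ : Interaction Λ q} (hΦ : Φ.IsLocal)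
    {A : Op Λ q} {X : Finset Λ} (hA : IsSupportedOn A X) :
    Commute (∑ Z ∈ univ.filter (fun Z : Finset Λ => Disjoint Z X), Φ Z) A := by
  refine Commute.sum_left _ _ _ fun Z hZ => ?_
  simp only [mem_filter, mem_univ, true_and] at hZ
  exact commute_of_disjoint_holds (hΦ.isSupportedOn Z) hA hZ

/-- The Heisenberg evolution is continuous in time. [folklore] -/
theorem continuous_heisenbergEvolution {n : Type*} [Fintype n] [DecidableEq n]
    (H A : Matrix n n ℂ) : Continuous fun t : ℝ => heisenbergEvolution H t A := by
  letI : NormedAlgebra ℚ (Matrix n n ℂ) := .restrictScalars ℚ ℂ _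
  have h : (fun t : ℝ => heisenbergEvolution H t A) =
      fun t : ℝ => exp (t • (I • H)) * A * exp (t • (-(I • H))) :=
    funext fun t => heisenbergEvolution_eq_exp_smul H t A
  rw [h]
  fun_prop

/-- **Counting the terms touching a region.** If `Σ_{Z ∋ x} ‖Φ Z‖ ≤ J` for every site `x`,
then `Σ_{Z ∩ X ≠ ∅} ‖Φ Z‖ ≤ #X · J` (every `Z` meeting `X` contains a site of `X`).
Nachtergaele–Sims (2006) §3.1. [folklore] -/
theorem sum_norm_filter_not_disjoint_le {Φ : Interaction Λ q} {J : ℝ}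
    (hJ : ∀ x : Λ, ∑ Z ∈ univ.filter (fun Z : Finset Λ => x ∈ Z), ‖Φ Z‖ ≤ J) (X : Finset Λ) :
    ∑ Z ∈ univ.filter (fun Z : Finset Λ => ¬ Disjoint Z X), ‖Φ Z‖ ≤ #X * J := by
  -- double counting: `Σ_{x ∈ X} Σ_{Z ∋ x} ‖Φ Z‖ = Σ_Z #(X ∩ Z) ‖Φ Z‖ ≥ Σ_{Z ∩ X ≠ ∅} ‖Φ Z‖`
  have h1 : ∑ x ∈ X, ∑ Z ∈ univ.filter (fun Z : Finset Λ => x ∈ Z), ‖Φ Z‖ =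
      ∑ Z : Finset Λ, (#(X.filter fun x => x ∈ Z) : ℝ) * ‖Φ Z‖ := by
    simp only [sum_filter, card_eq_sum_ones, Nat.cast_sum, sum_mul]
    rw [sum_comm]
    refine sum_congr rfl fun Z _ => sum_congr rfl fun x _ => ?_
    split_ifs <;> simp
  have h2 : ∑ Z ∈ univ.filter (fun Z : Finset Λ => ¬ Disjoint Z X), ‖Φ Z‖ ≤
      ∑ Z : Finset Λ, (#(X.filter fun x => x ∈ Z) : ℝ) * ‖Φ Z‖ := by
    calc ∑ Z ∈ univ.filter (fun Z : Finset Λ => ¬ Disjoint Z X), ‖Φ Z‖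
        ≤ ∑ Z ∈ univ.filter (fun Z : Finset Λ => ¬ Disjoint Z X),
            (#(X.filter fun x => x ∈ Z) : ℝ) * ‖Φ Z‖ := by
          refine sum_le_sum fun Z hZ => ?_
          simp only [mem_filter, mem_univ, true_and, not_disjoint_iff] at hZ
          obtain ⟨x, hxZ, hxX⟩ := hZ
          have hpos : (1 : ℝ) ≤ #(X.filter fun x => x ∈ Z) := by
            exact_mod_cast card_pos.mpr ⟨x, mem_filter.mpr ⟨hxX, hxZ⟩⟩
          calc ‖Φ Z‖ = 1 * ‖Φ Z‖ := (one_mul _).symm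
            _ ≤ _ := mul_le_mul_of_nonneg_right hpos (norm_nonneg _)
      _ ≤ _ := sum_le_sum_of_subset_of_nonneg (filter_subset _ _) fun Z _ _ => by positivity
  calc _ ≤ _ := h2
    _ = ∑ x ∈ X, ∑ Z ∈ univ.filter (fun Z : Finset Λ => x ∈ Z), ‖Φ Z‖ := h1.symm
    _ ≤ ∑ x ∈ X, J := sum_le_sum fun x _ => hJ x
    _ = #X * J := by rw [sum_const, nsmul_eq_mul]

/-- The local norm bound `Σ_{Z ∋ x} ‖Φ Z‖ ≤ J` forces `0 ≤ J` as soon as there is a site.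
[folklore] -/
theorem nonneg_of_sum_norm_le {Φ : Interaction Λ q} {J : ℝ}
    (hJ : ∀ x : Λ, ∑ Z ∈ univ.filter (fun Z : Finset Λ => x ∈ Z), ‖Φ Z‖ ≤ J) (x : Λ) : 0 ≤ J :=
  (sum_nonneg fun _ _ => norm_nonneg _).trans (hJ x)

end Lattice

/-! ### The core inequality for a local interaction and its iteration -/

section Iterate

variable {Λ : Type*} [Fintype Λ] [DecidableEq Λ] {q : ℕ}

/-- **The integral inequality for a local interaction** (`norm_comm_heisenbergEvolution_le` with
`H' = Σ_{Z ∩ X = ∅} Φ Z`): for `A ∈ 𝔄_X`, any `B` and `s ≥ 0`,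
`‖[τ_s(A), B]‖ ≤ ‖[A, B]‖ + 2‖A‖ ∫₀ˢ Σ_{Z ∩ X ≠ ∅} ‖[τ_u(Φ Z), B]‖ du`.
Nachtergaele–Ogata–Sims (2006), proof of Theorem 2.1 (arXiv:math-ph/0603064 p. 4).
[cite: NachtergaeleOgataSimsJSP2006, proof of Thm 2.1 (arXiv:math-ph/0603064 p. 4)] -/
theorem norm_comm_heisenbergEvolution_le_integral_sum {Φ : Interaction Λ q} (hΦ : Φ.IsLocal)
    {A : Op Λ q} {X : Finset Λ} (hA : IsSupportedOn A X) (B : Op Λ q) {s : ℝ} (hs : 0 ≤ s) :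
    ‖heisenbergEvolution (localHamiltonian Φ univ) s A * B -
        B * heisenbergEvolution (localHamiltonian Φ univ) s A‖ ≤
      ‖A * B - B * A‖ + 2 * ‖A‖ * ∫ u in (0 : ℝ)..s,
        ∑ Z ∈ univ.filter (fun Z : Finset Λ => ¬ Disjoint Z X),
          ‖heisenbergEvolution (localHamiltonian Φ univ) u (Φ Z) * B -
            B * heisenbergEvolution (localHamiltonian Φ univ) u (Φ Z)‖ := by
  set H := localHamiltonian Φ univ with hH
  set H' := ∑ Z ∈ univ.filter (fun Z : Finset Λ => Disjoint Z X), Φ Z with hH'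
  have hHh : H.IsHermitian := localHamiltonian_isHermitian hΦ univ
  have hH'h : H'.IsHermitian := isHermitian_sum_interaction hΦ _
  have hc : Commute H' A := hΦ.commute_sum_filter_disjoint hA
  have hdiff : H - H' = ∑ Z ∈ univ.filter (fun Z : Finset Λ => ¬ Disjoint Z X), Φ Z := by
    rw [hH, localHamiltonian_univ, hH', sum_sub_sum_filter_disjoint]
  have h0 := norm_comm_heisenbergEvolution_le hHh hH'h hc B s
  refine h0.trans (add_le_add le_rfl (mul_le_mul_of_nonneg_left ?_ (by positivity)))
  -- compare the integrands
  set f : ℝ → ℝ := fun u => ‖heisenbergEvolution H u (H - H') * B -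
    B * heisenbergEvolution H u (H - H')‖ with hf
  set g : ℝ → ℝ := fun u => ∑ Z ∈ univ.filter (fun Z : Finset Λ => ¬ Disjoint Z X),
    ‖heisenbergEvolution H u (Φ Z) * B - B * heisenbergEvolution H u (Φ Z)‖ with hg
  have hfg : ∀ u, f u ≤ g u := fun u => by
    simp only [hf, hg, hdiff, heisenbergEvolution_sum]
    exact norm_sum_commutator_le _ _ _
  have hfc : Continuous f := by
    simp only [hf]
    exact ((continuous_heisenbergEvolution H (H - H')).mul continuous_const).sub
      (continuous_const.mul (continuous_heisenbergEvolution H (H - H'))) |>.norm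
  have hgc : Continuous g := by
    simp only [hg]
    refine continuous_finsetSum _ fun Z _ => ?_
    exact ((continuous_heisenbergEvolution H (Φ Z)).mul continuous_const).sub
      (continuous_const.mul (continuous_heisenbergEvolution H (Φ Z))) |>.norm
  have hfnn : 0 ≤ ∫ u in (0 : ℝ)..s, f u :=
    intervalIntegral.integral_nonneg hs fun u _ => norm_nonneg _
  rw [abs_of_nonneg hfnn]
  exact intervalIntegral.integral_mono_on hs (hfc.intervalIntegrable 0 s)
    (hgc.intervalIntegrable 0 s) fun u _ => hfg u

/-- **The iterated Lieb–Robinson inequality.** For a local interaction `Φ` with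
`Σ_{Z ∋ x} ‖Φ Z‖ ≤ J` (`0 ≤ J`), `#Z ≤ V` whenever `Φ Z ≠ 0` (`1 ≤ V`), `B ∈ 𝔄_Y`, and a grading
`δ` of the regions with `δ Z > 0 ⟹ Z ∩ Y = ∅` and `δ Z ≤ δ Z' + 1` whenever `Φ Z' ≠ 0` meets `Z`:
for every `A ∈ 𝔄_X`, `s ≥ 0` and `N`,
`‖[τ_s(A), B]‖ ≤ 2‖A‖‖B‖ (𝟙[δX = 0] + (#X/V)(Σ_{n=max(1,δX)}^{N} (cs)ⁿ/n! + (cs)^{N+1}/(N+1)!))`,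
`c = 2VJ` (induction on `N`, integrating the bound for the terms `Φ Z`, `Z ∩ X ≠ ∅`).
Nachtergaele–Sims, CMP **265** (2006), §3.1, iteration of the integral inequality (arXiv
math-ph/0506030 p. 6: "Iteration of (cineq2) yields …"). [cite: NachtergaeleSimsCMP2006, §3.1 proof of Thm 1 (arXiv:math-ph/0506030 p. 6)] -/
theorem norm_comm_le_iterate {Φ : Interaction Λ q} (hΦ : Φ.IsLocal) {Y : Finset Λ} {B : Op Λ q}
    (hB : IsSupportedOn B Y) (δ : Finset Λ → ℕ) (hδY : ∀ Z, 0 < δ Z → Disjoint Z Y)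
    (hδ : ∀ Z Z', Φ Z' ≠ 0 → ¬ Disjoint Z' Z → δ Z ≤ δ Z' + 1) {J : ℝ} (hJ0 : 0 ≤ J)
    (hJ : ∀ x : Λ, ∑ Z ∈ univ.filter (fun Z : Finset Λ => x ∈ Z), ‖Φ Z‖ ≤ J) {V : ℕ}
    (hV1 : 1 ≤ V) (hV : ∀ Z, Φ Z ≠ 0 → #Z ≤ V) (N : ℕ) :
    ∀ (X : Finset Λ) (A : Op Λ q), IsSupportedOn A X → ∀ s : ℝ, 0 ≤ s →
      ‖heisenbergEvolution (localHamiltonian Φ univ) s A * B -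
          B * heisenbergEvolution (localHamiltonian Φ univ) s A‖ ≤
        2 * ‖A‖ * ‖B‖ * ((if δ X = 0 then 1 else 0) + (#X / V) *
          (∑ n ∈ Icc (max 1 (δ X)) N, (2 * V * J * s) ^ n / n ! +
            (2 * V * J * s) ^ (N + 1) / (N + 1)!)) := by
  set H := localHamiltonian Φ univ with hH
  have hHh : H.IsHermitian := localHamiltonian_isHermitian hΦ univ
  have hVpos : (0 : ℝ) < V := by exact_mod_cast hV1
  have hc0 : 0 ≤ 2 * (V : ℝ) * J := by positivity
  -- the initial commutator
  have hinit : ∀ (X : Finset Λ) (A : Op Λ q), IsSupportedOn A X →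
      ‖A * B - B * A‖ ≤ 2 * ‖A‖ * ‖B‖ * (if δ X = 0 then 1 else 0) := by
    intro X A hA
    by_cases h0 : δ X = 0
    · rw [if_pos h0, mul_one]; exact norm_commutator_le A B
    · rw [if_neg h0, mul_zero]
      have hdisj : Disjoint X Y := hδY X (Nat.pos_of_ne_zero h0)
      rw [(commute_of_disjoint_holds hA hB hdisj).eq, sub_self, norm_zero]
  -- the terms touching `X`
  have hsumX : ∀ X : Finset Λ,
      ∑ Z ∈ univ.filter (fun Z : Finset Λ => ¬ Disjoint Z X), ‖Φ Z‖ ≤ #X * J :=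
    fun X => sum_norm_filter_not_disjoint_le hJ X
  -- continuity of the integrand
  have hcontsum : ∀ X : Finset Λ, Continuous fun u : ℝ =>
      ∑ Z ∈ univ.filter (fun Z : Finset Λ => ¬ Disjoint Z X),
        ‖heisenbergEvolution H u (Φ Z) * B - B * heisenbergEvolution H u (Φ Z)‖ := fun X =>
    continuous_finsetSum _ fun Z _ =>
      (((continuous_heisenbergEvolution H (Φ Z)).mul continuous_const).sub
        (continuous_const.mul (continuous_heisenbergEvolution H (Φ Z)))).norm
  induction N with
  | zero =>
    intro X A hA s hs
    have hcore := norm_comm_heisenbergEvolution_le_integral_sum hΦ hA B hs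
    -- trivial bound on the integrand
    have hint : ∫ u in (0:ℝ)..s, ∑ Z ∈ univ.filter (fun Z : Finset Λ => ¬ Disjoint Z X),
        ‖heisenbergEvolution H u (Φ Z) * B - B * heisenbergEvolution H u (Φ Z)‖ ≤
        ∫ u in (0:ℝ)..s, 2 * ‖B‖ * (#X * J) := by
      refine intervalIntegral.integral_mono_on hs ((hcontsum X).intervalIntegrable 0 s)
        intervalIntegrable_const fun u _ => ?_
      calc ∑ Z ∈ univ.filter (fun Z : Finset Λ => ¬ Disjoint Z X),
            ‖heisenbergEvolution H u (Φ Z) * B - B * heisenbergEvolution H u (Φ Z)‖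
          ≤ ∑ Z ∈ univ.filter (fun Z : Finset Λ => ¬ Disjoint Z X), 2 * ‖B‖ * ‖Φ Z‖ := by
            refine sum_le_sum fun Z _ => ?_
            calc _ ≤ 2 * ‖heisenbergEvolution H u (Φ Z)‖ * ‖B‖ := norm_commutator_le _ _
              _ = 2 * ‖B‖ * ‖Φ Z‖ := by rw [norm_heisenbergEvolution_holds hHh]; ring
        _ = 2 * ‖B‖ * ∑ Z ∈ univ.filter (fun Z : Finset Λ => ¬ Disjoint Z X), ‖Φ Z‖ := by
            rw [mul_sum]
        _ ≤ 2 * ‖B‖ * (#X * J) := mul_le_mul_of_nonneg_left (hsumX X) (by positivity)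
    rw [intervalIntegral.integral_const, sub_zero, smul_eq_mul] at hint
    have h1 := hinit X A hA
    have hIcc : Icc (max 1 (δ X)) 0 = ∅ := by
      ext n
      simp only [mem_Icc, notMem_empty, iff_false, not_and, not_le]
      omega
    rw [hIcc, sum_empty, zero_add, zero_add, Nat.factorial_one, Nat.cast_one, div_one, pow_one]
    calc _ ≤ ‖A * B - B * A‖ + 2 * ‖A‖ * (s * (2 * ‖B‖ * (#X * J))) :=
          hcore.trans (add_le_add le_rfl (mul_le_mul_of_nonneg_left hint (by positivity)))
      _ ≤ 2 * ‖A‖ * ‖B‖ * (if δ X = 0 then 1 else 0) + 2 * ‖A‖ * (s * (2 * ‖B‖ * (#X * J))) :=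
          add_le_add h1 le_rfl
      _ = 2 * ‖A‖ * ‖B‖ * ((if δ X = 0 then 1 else 0) + (#X / V) * (2 * V * J * s)) := by
          have hVne : (V : ℝ) ≠ 0 := ne_of_gt hVpos
          have hcc : (#X : ℝ) / V * (2 * V * J * s) = 2 * (#X * J) * s := by
            calc (#X : ℝ) / V * (2 * V * J * s) = 2 * (#X * J) * s * (V / V) := by ring
              _ = 2 * (#X * J) * s := by rw [div_self hVne, mul_one]
          rw [hcc]
          ring
  | succ N ih =>
    intro X A hA s hs
    have hcore := norm_comm_heisenbergEvolution_le_integral_sum hΦ hA B hs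
    set c : ℝ := 2 * V * J with hc
    set a : ℕ := max 1 (δ X - 1) with ha
    -- the integrand bound `g`
    set g : ℝ → ℝ := fun u => 2 * ‖B‖ * ((if δ X ≤ 1 then 1 else 0) +
      (∑ n ∈ Icc a N, (c * u) ^ n / n ! + (c * u) ^ (N + 1) / (N + 1)!)) with hg
    have hg0 : ∀ u, 0 ≤ u → 0 ≤ g u := fun u hu => by
      simp only [hg]
      have : 0 ≤ c * u := mul_nonneg hc0 hu
      positivity
    have hgc : Continuous g := by
      simp only [hg]
      fun_prop
    -- pointwise bound of each term by `‖Φ Z‖ g u` (induction hypothesis at `Z`)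
    have hterm : ∀ u, 0 ≤ u → ∀ Z ∈ univ.filter (fun Z : Finset Λ => ¬ Disjoint Z X),
        ‖heisenbergEvolution H u (Φ Z) * B - B * heisenbergEvolution H u (Φ Z)‖ ≤
          ‖Φ Z‖ * g u := by
      intro u hu Z hZ
      simp only [mem_filter, mem_univ, true_and] at hZ
      by_cases hΦZ : Φ Z = 0
      · have : heisenbergEvolution H u (Φ Z) = 0 := by simp [hΦZ, heisenbergEvolution]
        rw [this, zero_mul, mul_zero, sub_self, norm_zero]
        exact mul_nonneg (norm_nonneg _) (hg0 u hu)
      have hIH := ih Z (Φ Z) (hΦ.isSupportedOn Z) u hu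
      have hδZ : δ X ≤ δ Z + 1 := hδ X Z hΦZ hZ
      have hZV : (#Z : ℝ) / V ≤ 1 := by
        rw [div_le_one hVpos]
        exact_mod_cast hV Z hΦZ
      refine hIH.trans ?_
      rw [show 2 * ‖Φ Z‖ * ‖B‖ = ‖Φ Z‖ * (2 * ‖B‖) by ring, hg, mul_assoc]
      refine mul_le_mul_of_nonneg_left (mul_le_mul_of_nonneg_left (add_le_add ?_ ?_)
        (by positivity)) (norm_nonneg _)
      · -- `𝟙[δZ = 0] ≤ 𝟙[δX ≤ 1]`
        by_cases hZ0 : δ Z = 0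
        · rw [if_pos hZ0, if_pos (by omega)]
        · rw [if_neg hZ0]
          split_ifs <;> norm_num
      · have hcu : 0 ≤ c * u := mul_nonneg hc0 hu
        have hsub : Icc (max 1 (δ Z)) N ⊆ Icc a N := Icc_subset_Icc (by omega) le_rfl
        calc (#Z : ℝ) / V * (∑ n ∈ Icc (max 1 (δ Z)) N, (c * u) ^ n / n ! +
              (c * u) ^ (N + 1) / (N + 1)!)
            ≤ 1 * (∑ n ∈ Icc (max 1 (δ Z)) N, (c * u) ^ n / n ! +
              (c * u) ^ (N + 1) / (N + 1)!) :=
              mul_le_mul_of_nonneg_right hZV (by positivity)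
          _ ≤ ∑ n ∈ Icc a N, (c * u) ^ n / n ! + (c * u) ^ (N + 1) / (N + 1)! := by
              rw [one_mul]
              exact add_le_add
                (sum_le_sum_of_subset_of_nonneg hsub fun n _ _ => by positivity) le_rfl
    -- integrate the bound
    set T : ℝ := s * (if δ X ≤ 1 then 1 else 0) +
      (∑ n ∈ Icc a N, c ^ n * s ^ (n + 1) / (n + 1)! + c ^ (N + 1) * s ^ (N + 2) / (N + 2)!)
      with hT
    have hint : ∫ u in (0:ℝ)..s, ∑ Z ∈ univ.filter (fun Z : Finset Λ => ¬ Disjoint Z X),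
        ‖heisenbergEvolution H u (Φ Z) * B - B * heisenbergEvolution H u (Φ Z)‖ ≤
        (#X * J) * (2 * ‖B‖ * T) := by
      have heval : ∫ u in (0:ℝ)..s, (#X * J) * g u = (#X * J) * (2 * ‖B‖ * T) := by
        rw [intervalIntegral.integral_const_mul, hg, integral_iterBound]
      rw [← heval]
      refine intervalIntegral.integral_mono_on hs ((hcontsum X).intervalIntegrable 0 s)
        ((continuous_const.mul hgc).intervalIntegrable 0 s) fun u hu => ?_
      calc _ ≤ ∑ Z ∈ univ.filter (fun Z : Finset Λ => ¬ Disjoint Z X), ‖Φ Z‖ * g u :=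
            sum_le_sum (hterm u hu.1)
        _ = (∑ Z ∈ univ.filter (fun Z : Finset Λ => ¬ Disjoint Z X), ‖Φ Z‖) * g u := by
            rw [sum_mul]
        _ ≤ (#X * J) * g u := mul_le_mul_of_nonneg_right (hsumX X) (hg0 u hu.1)
    -- `c T ≤ Σ' + last'`
    have hcT : c * T ≤ ∑ n ∈ Icc (max 1 (δ X)) (N + 1), (c * s) ^ n / n ! +
        (c * s) ^ (N + 2) / (N + 2)! := by
      have hre := mul_indicator_add_sum_Icc_le (c * s) (δ X) N
      have hpow : ∀ n : ℕ, c * (c ^ n * s ^ (n + 1) / (n + 1)!) = (c * s) ^ (n + 1) / (n + 1)! := by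
        intro n; rw [mul_pow]; ring
      rw [hT, mul_add, mul_add, mul_sum]
      simp only [hpow, ← add_assoc]
      refine add_le_add ?_ le_rfl
      rw [show c * (s * (if δ X ≤ 1 then 1 else 0)) = c * s * (if δ X ≤ 1 then 1 else 0) by ring,
        ha]
      exact hre
    have h1 := hinit X A hA
    have hXV : (0 : ℝ) ≤ #X / V := by positivity
    calc _ ≤ ‖A * B - B * A‖ + 2 * ‖A‖ * ((#X * J) * (2 * ‖B‖ * T)) :=
          hcore.trans (add_le_add le_rfl (mul_le_mul_of_nonneg_left hint (by positivity)))
      _ = ‖A * B - B * A‖ + 2 * ‖A‖ * ‖B‖ * ((#X / V) * (c * T)) := by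
          have hVne : (V : ℝ) ≠ 0 := ne_of_gt hVpos
          have hcc : (#X : ℝ) / V * c = 2 * (#X * J) := by
            calc (#X : ℝ) / V * c = 2 * (#X * J) * (V / V) := by rw [hc]; ring
              _ = 2 * (#X * J) := by rw [div_self hVne, mul_one]
          rw [← mul_assoc ((#X : ℝ) / V) c T, hcc]
          ring
      _ ≤ 2 * ‖A‖ * ‖B‖ * (if δ X = 0 then 1 else 0) + 2 * ‖A‖ * ‖B‖ * ((#X / V) *
          (∑ n ∈ Icc (max 1 (δ X)) (N + 1), (c * s) ^ n / n ! + (c * s) ^ (N + 2) / (N + 2)!)) :=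
          add_le_add h1 (mul_le_mul_of_nonneg_left (mul_le_mul_of_nonneg_left hcT hXV)
            (by positivity))
      _ = _ := by rw [← mul_add]

/-! ### The Lieb–Robinson bound -/

/-- **Lieb–Robinson bound, non-negative times.** Under the hypotheses of `norm_comm_le_iterate`,
for `A ∈ 𝔄_X` with `δ X ≥ 1`, `0 ≤ μ` and `s ≥ 0`:
`‖[τ_s(A), B]‖ ≤ 2‖A‖‖B‖ (#X/V) exp(−μ δX + 2 e^μ V J s)`
(let `N → ∞` in the iterated inequality and bound the exponential tail
`Σ_{n ≥ δX} (cs)ⁿ/n! ≤ e^{−μ δX} e^{e^μ cs}`). Nachtergaele–Sims, CMP **265** (2006) 119, Thm 1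
and §3.1; Nachtergaele–Ogata–Sims, JSP **124** (2006) 1, Thm 2.1.
[cite: NachtergaeleSimsCMP2006, Thm 1 and §3.1 (arXiv:math-ph/0506030 pp. 4, 6)] -/
theorem norm_comm_heisenbergEvolution_le_exp_of_nonneg {Φ : Interaction Λ q} (hΦ : Φ.IsLocal)
    {X Y : Finset Λ} {A B : Op Λ q} (hA : IsSupportedOn A X) (hB : IsSupportedOn B Y)
    (δ : Finset Λ → ℕ) (hδY : ∀ Z, 0 < δ Z → Disjoint Z Y)
    (hδ : ∀ Z Z', Φ Z' ≠ 0 → ¬ Disjoint Z' Z → δ Z ≤ δ Z' + 1) (hX : 0 < δ X) {J : ℝ}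
    (hJ0 : 0 ≤ J) (hJ : ∀ x : Λ, ∑ Z ∈ univ.filter (fun Z : Finset Λ => x ∈ Z), ‖Φ Z‖ ≤ J)
    {V : ℕ} (hV1 : 1 ≤ V) (hV : ∀ Z, Φ Z ≠ 0 → #Z ≤ V) {μ : ℝ} (hμ : 0 ≤ μ) {s : ℝ}
    (hs : 0 ≤ s) :
    ‖heisenbergEvolution (localHamiltonian Φ univ) s A * B -
        B * heisenbergEvolution (localHamiltonian Φ univ) s A‖ ≤
      2 * ‖A‖ * ‖B‖ * (#X / V) * Real.exp (-(μ * δ X) + 2 * Real.exp μ * V * J * s) := by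
  set c : ℝ := 2 * V * J with hc
  have hc0 : 0 ≤ c := by rw [hc]; positivity
  have hcs : 0 ≤ c * s := mul_nonneg hc0 hs
  set L : ℝ := ‖heisenbergEvolution (localHamiltonian Φ univ) s A * B -
    B * heisenbergEvolution (localHamiltonian Φ univ) s A‖ with hL
  -- the bound for every `N`, with the tail already estimated
  have hN : ∀ N : ℕ, L ≤ 2 * ‖A‖ * ‖B‖ * ((#X / V) *
      (Real.exp (-(μ * δ X)) * Real.exp (Real.exp μ * (c * s)) +
        (c * s) ^ (N + 1) / (N + 1)!)) := by
    intro N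
    have h := norm_comm_le_iterate hΦ hB δ hδY hδ hJ0 hJ hV1 hV N X A hA s hs
    rw [if_neg (Nat.pos_iff_ne_zero.mp hX), zero_add, ← hc,
      show max 1 (δ X) = δ X from max_eq_right hX] at h
    refine h.trans (mul_le_mul_of_nonneg_left (mul_le_mul_of_nonneg_left
      (add_le_add ?_ le_rfl) (by positivity)) (by positivity))
    exact sum_Icc_pow_div_factorial_le hcs hμ (δ X) N
  -- let `N → ∞`
  have hlim : Tendsto (fun N : ℕ => 2 * ‖A‖ * ‖B‖ * ((#X / V) *
      (Real.exp (-(μ * δ X)) * Real.exp (Real.exp μ * (c * s)) +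
        (c * s) ^ (N + 1) / (N + 1)!))) atTop
      (𝓝 (2 * ‖A‖ * ‖B‖ * ((#X / V) *
        (Real.exp (-(μ * δ X)) * Real.exp (Real.exp μ * (c * s)) + 0)))) := by
    have h0 : Tendsto (fun N : ℕ => (c * s) ^ (N + 1) / (N + 1)!) atTop (𝓝 0) :=
      (FloorSemiring.tendsto_pow_div_factorial_atTop (c * s)).comp (tendsto_add_atTop_nat 1)
    exact tendsto_const_nhds.mul (tendsto_const_nhds.mul (tendsto_const_nhds.add h0))
  have hle := ge_of_tendsto' hlim hN
  rw [add_zero] at hle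
  refine hle.trans (le_of_eq ?_)
  rw [Real.exp_add, hc]
  ring_nf

/-- Negating the interaction reverses time: `τ_t^{H}(A) = τ_{−t}^{−H}(A)` and
`localHamiltonian (−Φ) = −localHamiltonian Φ`. [folklore] -/
theorem heisenbergEvolution_neg_localHamiltonian (Φ : Interaction Λ q) (t : ℝ) (A : Op Λ q) :
    heisenbergEvolution (localHamiltonian (-Φ) univ) (-t) A =
      heisenbergEvolution (localHamiltonian Φ univ) t A := by
  have hneg : localHamiltonian (-Φ) univ = -localHamiltonian Φ univ := by
    simp only [localHamiltonian, ← sum_neg_distrib]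
    rfl
  rw [hneg, heisenbergEvolution, heisenbergEvolution]
  congr 2
  · congr 1
    rw [smul_neg, ← neg_smul]
    push_cast
    ring_nf
  · rw [smul_neg, ← neg_smul]
    push_cast
    ring_nf

/-- The negative of a local interaction is local. [folklore] -/
theorem Interaction.IsLocal.neg {Φ : Interaction Λ q} (hΦ : Φ.IsLocal) : (-Φ).IsLocal := by
  intro X
  have h1 : (-Φ) X = (-1 : ℂ) • Φ X := by rw [neg_one_smul]; rfl
  rw [h1]
  refine ⟨(hΦ.isSupportedOn X).smul (-1), ?_⟩
  rw [neg_one_smul]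
  exact (hΦ.isHermitian X).neg

/-- **The Lieb–Robinson bound** (finite volume, abstract grading). Let `Φ` be a local interaction
on the finite site set `Λ` with `Σ_{Z ∋ x} ‖Φ Z‖ ≤ J` for all sites `x` (`0 ≤ J`) and `#Z ≤ V`
whenever `Φ Z ≠ 0` (`1 ≤ V`); let `A ∈ 𝔄_X`, `B ∈ 𝔄_Y`, and let `δ : Finset Λ → ℕ` be a grading with
`δ Z > 0 ⟹ Z ∩ Y = ∅` and `δ Z ≤ δ Z' + 1` whenever `Φ Z' ≠ 0` and `Z' ∩ Z ≠ ∅` (e.g.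
`δ Z = ⌈d(Z, Y)/R⌉` for an interaction of range `R`). Then for every `μ ≥ 0` and every time `t`,

`‖[τ_t(A), B]‖ ≤ 2 ‖A‖ ‖B‖ (#X/V) exp(−μ δ(X) + 2 e^μ V J |t|)`,

`τ_t` the Heisenberg dynamics of `H = Σ_Z Φ Z`. With the metric grading this is the Lieb–Robinson
bound in the form of Nachtergaele–Sims, CMP **265** (2006) 119, Theorem 1 (single-site `A`; for
`B ∈ 𝔄_Y`: "`‖[τ_t(A),B]‖ ≤ 2|Y| ‖A‖‖B‖ e^{2|t|‖Φ‖_λ − λ d(x,Y)}`", arXiv:math-ph/0506030 p. 4) and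
of Nachtergaele–Ogata–Sims, JSP **124** (2006) 1, Theorem 2.1 (multi-site `A ∈ 𝔄_X`); originally
Lieb–Robinson, CMP **28** (1972) 251. Negative times are reduced to positive ones by `Φ ↦ −Φ`.
[cite: NachtergaeleSimsCMP2006, Thm 1 (arXiv:math-ph/0506030 p. 4)] -/
theorem norm_comm_heisenbergEvolution_le_exp {Φ : Interaction Λ q} (hΦ : Φ.IsLocal)
    {X Y : Finset Λ} {A B : Op Λ q} (hA : IsSupportedOn A X) (hB : IsSupportedOn B Y)
    (δ : Finset Λ → ℕ) (hδY : ∀ Z, 0 < δ Z → Disjoint Z Y)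
    (hδ : ∀ Z Z', Φ Z' ≠ 0 → ¬ Disjoint Z' Z → δ Z ≤ δ Z' + 1) (hX : 0 < δ X) {J : ℝ}
    (hJ0 : 0 ≤ J) (hJ : ∀ x : Λ, ∑ Z ∈ univ.filter (fun Z : Finset Λ => x ∈ Z), ‖Φ Z‖ ≤ J)
    {V : ℕ} (hV1 : 1 ≤ V) (hV : ∀ Z, Φ Z ≠ 0 → #Z ≤ V) {μ : ℝ} (hμ : 0 ≤ μ) (t : ℝ) :
    ‖heisenbergEvolution (localHamiltonian Φ univ) t A * B -
        B * heisenbergEvolution (localHamiltonian Φ univ) t A‖ ≤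
      2 * ‖A‖ * ‖B‖ * (#X / V) * Real.exp (-(μ * δ X) + 2 * Real.exp μ * V * J * |t|) := by
  rcases le_or_gt 0 t with ht | ht
  · rw [abs_of_nonneg ht]
    exact norm_comm_heisenbergEvolution_le_exp_of_nonneg hΦ hA hB δ hδY hδ hX hJ0 hJ hV1 hV hμ ht
  · -- negative times: pass to `-Φ` and `-t`
    rw [abs_of_neg ht, ← heisenbergEvolution_neg_localHamiltonian Φ t A]
    have hneg : ∀ Z, (-Φ) Z = -(Φ Z) := fun Z => rfl
    have hδ' : ∀ Z Z', (-Φ) Z' ≠ 0 → ¬ Disjoint Z' Z → δ Z ≤ δ Z' + 1 := fun Z Z' h =>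
      hδ Z Z' (by rwa [hneg, neg_ne_zero] at h)
    have hJ' : ∀ x : Λ, ∑ Z ∈ univ.filter (fun Z : Finset Λ => x ∈ Z), ‖(-Φ) Z‖ ≤ J :=
      fun x => by simpa only [hneg, norm_neg] using hJ x
    have hV' : ∀ Z, (-Φ) Z ≠ 0 → #Z ≤ V := fun Z h => hV Z (by rwa [hneg, neg_ne_zero] at h)
    exact norm_comm_heisenbergEvolution_le_exp_of_nonneg hΦ.neg hA hB δ hδY hδ' hX hJ0 hJ' hV1
      hV' hμ (neg_nonneg.mpr ht.le)

end Iterate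

end Literature.MathematicalPhysics.QuantumLattice
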